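import Summits.BirchSwinnertonDyer.Rank1Residual.F1Sign2.AnalyticLineTransferAtTwo
import Summits.BirchSwinnertonDyer.Rank1Residual.F1Sign2.BranchCongruenceModTwoAtTwo
import Literature.NumberTheory.EllipticCurves.GreenbergVatsal2000.NonPrimitivePAdicLFunction
import Literature.NumberTheory.EllipticCurves.CanonicalPeriodSymbolCongruence
import Mathlib.NumberTheory.Padics.PadicNumbers
import HarnessLib

/-!
# Cell `bsd-f1-sign2` — IMC lens (seat `-imc`) g2: **IMC-SYMB, the SYMBOL FORM of `AnalyticLineTransferAtTwo`**
# (fixed level, Part B) and its `S`-DEPLETED CROSS-LEVEL form in the `ι`-orientation (Part C′)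

Companion to the TREE file `F1Sign2/AnalyticLineTransferAtTwo.lean` (p553953 = SketchG2-LineTransfer v1.2; v1.3 stratum
split `OnKilfordStratumAtTwo` / `AnalyticLineTransferAtTwoOnStratum` / `…OffStratum` / `analyticLineTransferAtTwo_iff_strata`
appended by p564205), which this file imports and does not duplicate. STATEMENTS ONLY: two `@[conjecture] def`s (OPEN
obligations of ours — candidates, NOT published results) and three proved glue lemmas; nothing asserted, no `sorry`, no
named fact.

* Part B (MEMO-imc §10.21): the mechanism statement `SymbolLineTransferAtTwo` (IMC-SYMB: at a fixed level, aligned lines ⇒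
  equal unit-normalised mod-2 reductions of the even-branch 2-adic `L`-functions) and the proved glue
  `lam_eq_of_red_pfree_eq` (symbol form ⇒ `λ`-form with no `e`-terms).
* Part C′ (MEMO-imc §10.21 (c′); REF1 §23's repair C′): `SymbolLineTransferAtTwoSigmaR`, the Emerton–Pollack–Weston form
  at `p = 2` — ACROSS levels, `S`-depleted by the `ι`-ORIENTED Euler-factor product
  `GreenbergVatsal2000.eulerFactorProductInv` on BOTH sides — and the proved glue `pfree_mul_of_red_ne_zero`,
  `red_pfree_eq_of_depleted_eq` (Σ-form with equal depletion factors ⇒ undepleted symbol form).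
* Part D′ (appended 2026-08-27 by -ty g2 after REF1 §26): `PlusSymbolCongruenceAtTwoSemistable` (IMC-SYMB′, the
  Vatsal-shape classical plus-symbol congruence at `2`, fixed level) = REF1 §26.2's repair C′ of the sketch's Part D
  `PlusSymbolCongruenceAtTwo`, which is KILLED AS TYPED (class misstated — NO reduction-type clause at `2`: 3 087
  additive-at-2 violations among 16 620 pairs `N ≤ 8 281`, kit j288875, minimal witness `348a1 ~ 348b1`, kit j289153; that
  name is not filed); C′ inserts «`W₁`, `W₂` semistable at `2`» and is TWO-SIDED on the semistable census (typed-aligned ⇒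
  congruent 7 785/7 785, misaligned ⇒ 0/2 327). The GV-oriented Σ-form `SymbolLineTransferAtTwoSigma` of Strata
  v2.1–v2.3 is KILLED AS TYPED (REF1 §23, refuted-misstated, trap T15 ORIENTATION) and its name is retired.

FINDING (census, `MEMO-imc-data/dimc7/SYMTEST-census.txt` f7b9cbd04c272434, g2/symtest9.py on ALIGN j284481 + the
census ENGINE-D2 files; pre-registered as P12 for D-imc-9): for the 31 census pairs of congruent curves AT THE SAME LEVEL
(62 branch instances) the unit-normalised mod-2 reductions of the Mazur–Tate elements (128-bit layer-7 vectors = the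
mod-2 modular symbol read on `{a/2^9 → ∞}`) separate PERFECTLY: aligned at `2` AND at `∞` on branch `b` ⇒ the mod-2
symbols `φ̄ᵇ` are IDENTICAL (33/33; Hamming 0); misaligned at `2` OR at `∞` ⇒ `φ̄ᵇ` DIFFER (29/29; Hamming 49–69 of
128), on AND off the Kilford stratum. AT SCALE (D-imc-8 kit j285501, 1 320 pairs incl. prime twists; D-imc-9 kit j286203,
770 new ON-stratum rows `N ≤ 19 847`, ENGINE D2): fixed level — aligned ⇒ identical 483/483, `S₃`-misaligned ⇒ differ
2 113/2 113 (separation 2 596/2 596); cross-level Σ-form (`m = 6`, `ι`-orientation) — aligned ⇒ equal 2 180/2 180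
decisive on D-imc-8 (50 ON cross-level + 2 ON same-level; 112 deplete to zero) and 1 201/1 201 resolved on D-imc-9
(18 unresolved with `λ ≥ 16`, 0 fails); misaligned ⇒ differ 341/345 (the 4 coincidences all in the level-2089 `𝔪`).
Reading: where mod-2 multiplicity one fails (Kilford–Wiese 2008 Thm 1.2/1.3, Prop 2.2: `J[𝔪] ≅ ρ̄ ⊕ ρ̄`), the pair
(canonical 2-adic line, archimedean line of the branch) PINS DOWN the mod-2 eigensymbol — it is exactly the missing
multiplicity-one input of the Emerton–Pollack–Weston mechanism at `p = 2` (cf. Pollack–Weston 2011 §4–5 on symbols when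
mod-`p` multiplicity one fails, `p` odd). At a fixed level the `λ`-transfer (with no `e`-terms) FOLLOWS from symbol
equality (`lam_eq_of_red_pfree_eq`); across levels the `e`-terms are EPW's `ℓ`-stabilisation. So `SymbolLineTransferAtTwo`
is the MECHANISM statement behind `AnalyticLineTransferAtTwo`: `L`-value free in content (an identity of mod-2 modular
symbols), decidable level by level by exact rational modular-symbol arithmetic.

WHY NOVEL (MEMO-imc §10.21, search-before-claim both corpora): corpus `lit search --hybrid "mod 2 modular symbols congruent
elliptic curves multiplicity one fails Iwasawa lambda invariant canonical subgroup"` → textbook hits only (Silverman 1994 /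
Cornell–Silverman–Stevens 1997 / Hida 2000); galaxy pdf `"modular symbols mod 2|mod 2 modular symbol|modular symbols
modulo 2"` → 0 hits; nearest in content: EPW06 Thm 1 (mult one assumed), Pollack–Weston 2011 §5
[galaxy:pdf:-6535538855114364040 p21, p30] (p odd, symbol lines when mult one fails), Kilford–Wiese 2008
[corpus:paper:arxiv-math_0612317 p3–p6] (the failure itself, no `L`-functions).

REFUTER VERDICTS. REF1-AUDIT-v1 §21 (g3, 315d27a3a33ac44f) on Part B: SURVIVES (conjecture-grade, OPEN) — A1 rc 0, BC7
CLEAN [P3 timeout] 85.0 s; equal-conductor pairs only (shared level + `IsNewform0`); normalisation-free (`red ∘ pfree`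
invariant under `ℚˣ` and `ℤ₂ˣ·2^ℤ`); junk `G = 0` harmless (Rohrlich); `μ`-free to state, not in truth conditions; glue
PROVED. REF1 §23 (g3, e5125b83e5747348) on the Σ-form: the GV-oriented `…Sigma` (v2.1 = v2.2 e5cf6293d8ce2090) KILLED AS
TYPED (T15 orientation: the lifts are MTT-oriented, `GreenbergVatsal2000.eulerFactorProduct` is GV-oriented = the hybrid
pairing, FALSE on 60 aligned cross-level census instances, e.g. `503c1 ~ 5030c1`, `S = [5, 503]`); **C′ = the same
statement over `GreenbergVatsal2000.eulerFactorProductInv` — SURVIVES conjecture-grade** (supported 105/105, 2 180/2 180),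
glue `pfree_mul_of_red_ne_zero` / `red_pfree_eq_of_depleted_eq` PROVED and orientation-agnostic, BC7 CLEAN [P3] 111.3 s;
«-ty: file Part C only in the C′ form». REF2-PLACEMENT v10 (90821f6db648298b) §1/§6 and v11 (464e06f94986d43c):
`SymbolLineTransferAtTwo` NOT IN PRINT at `2`; OFF the Kilford stratum, `N` odd, `S₃`: IN-PRINT-ASSEMBLY (Buzzard 2001
Thm 6.1 + Ribet–Stein 2001 Rem 3.6 / Kilford 2002 §4 + bookkeeping); ON the stratum / even `N`: OPEN beyond print
(Wiese 2007 Cor 4.4) — beyond-print yes-modest, ON only (= IMC-LINE(ON) = IMC-CROSS, one object); Σ_R same words;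
the Σ-form is NOT IN PRINT at `2` (EPW06 Thm 1 is `p` odd).

TYPER FILING (seat `bsd-f1-sign2-ty` g2; CANDIDATES.md row IMC-SYMB): bodies VERBATIM from
`HOME/MEMO-imc-data/SketchG2-Strata-v2.4.lean` fb67d6cce5549af6 Parts B and C (rc 0, 0 sorry); checked before filing:
Part B body = the REF1 §21-audited `SketchG2-Strata-v1.lean` 06f310fe7c7856a7 body byte-for-byte; Part C′ body = the
REF1 §23-audited v2.2 Σ body with exactly the two substitutions REF1 §23 prescribes (name `…SigmaR`,
`eulerFactorProduct ↦ eulerFactorProductInv` on both sides); Part A of the sketch = the tree decls (p564205), imported.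
PARTITION: none moved; beyond-print theorem: no (statements). bears_on: F1 leaf 19097/19098 via IMC-LINE. -/

noncomputable section

open scoped Classical MatrixGroups ModularForm
open CongruenceSubgroup Polynomial
open Literature.NumberTheory.EllipticCurves Literature.NumberTheory.EllipticCurves.ModularForms
open Literature.NumberTheory.EllipticCurves.Greenberg1999
open Literature.NumberTheory.EllipticCurves.Rank1Residual
open Summit.BirchSwinnertonDyer.Rank1Residual.X1.MuLambda
open Summit.BirchSwinnertonDyer.Rank1Residual.X5
open IsDedekindDomain NumberField

set_option autoImplicit false

namespace Summit.BirchSwinnertonDyer.Rank1Residual.F1Sign2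

/-! ## Part B — the SYMBOL form at a fixed level (MEMO-imc §10.21; REF1 §21 SURVIVES) -/

/-- **Candidate `SymbolLineTransferAtTwo` (IMC-SYMB, even branch, fixed level; beyond print on the Kilford stratum).**
`E₁, E₂` height one at `2`, no rational `2`-torsion, `E₁[2] ≅ E₂[2]` realised by roots `e₁, e₂` of the
`u`-cubics in a common cubic field, ALIGNED at `2` and at `∞`, newforms `f₁, f₂` of the SAME level `N` (= the common
conductor, forced by `IsNewform0`; cross-level pairs such as `503c1 ~ 5030c1` are instances of
`SymbolLineTransferAtTwoSigmaR` (Part C′) and of IMC-LINE, not of this fixed-level statement — REF1 §21),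
`G₁, G₂` integral lifts of the even-branch `2`-adic `L`-functions: the UNIT-NORMALISED mod-2 reductions
coincide, `red (pfree G₁) = red (pfree G₂)` in `𝔽₂⟦T⟧` (invariant under rescaling either lift by `ℚˣ`,
`F1Sign2.red_pfree_eq_of_rat_smul`, so no period normalisation is presupposed and no `μ = 0` hypothesis is
needed to STATE it — if the primitive eigensymbol has positive 2-content on the span of the 2-power
cusps, `pfree` divides further and the asserted equality is deeper than mod-2 line equality (census:
`μ = 0` throughout, so this corner is unprobed; REF1 §21); equivalently, when that content is zero: the unit-normalised
mod-2 plus modular symbols of `f₁`, `f₂` agree on the `2`-power cusps). Census: 33/33 aligned instances equal, 29/29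
misaligned differ (both branches); at scale (D-imc-8/9): aligned identical 483/483, `S₃`-misaligned differ 2 113/2 113.
Why it might fail: a same-level aligned pair with `red (pfree G₁) ≠ red (pfree G₂)` — none in the census (top layer 7;
two low-layer wobbles at layers 1–2 where `μ_n` is not yet stable); `μ`-transfer is NOT part of this statement (that is
`AnalyticMuZeroAtTwo` / K2). REF1 §21: SURVIVES conjecture-grade (OPEN); REF2 v10: not in print at 2 — off-stratum odd
`N` in-print-assembly [cite: BuzzardEtAl2001, Thm. 6.1] [cite: RibetStein2001, Rem. 3.6], on-stratum open beyond print
[cite: Wiese2007Multiplicities, Cor. 4.4]; shape of the printed odd-`p` mechanism [cite: EmertonPollackWeston2006, Thm. 1]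
[cite: PollackWeston2011, §5]. -/
@[conjecture] def SymbolLineTransferAtTwo : Prop :=
  ∀ (W₁ : WeierstrassCurve ℚ) [W₁.IsElliptic] [W₁.IsGloballyMinimal]
    (W₂ : WeierstrassCurve ℚ) [W₂.IsElliptic] [W₂.IsGloballyMinimal],
    (∀ x : ℚ, ¬ HasRationalTwoTorsionX W₁ x) → (∀ x : ℚ, ¬ HasRationalTwoTorsionX W₂ x) →
    ∀ (F : Type) [Field F] [NumberField F], Module.finrank ℚ F = 3 →
    ∀ e₁ e₂ : F, aeval e₁ (twoDivisionUCubic W₁) = 0 → aeval e₂ (twoDivisionUCubic W₂) = 0 →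
    AlignedAtTwo F e₁ e₂ →
    AlignedAtInfinity F (twoDivisionUCubic W₁) (twoDivisionUCubic W₂) e₁ e₂ →
    ∀ ⦃N : ℕ⦄ [NeZero N] (f₁ f₂ : CuspForm (Gamma0 N) 2), IsNewformOf W₁ f₁ → IsNewformOf W₂ f₂ →
    ∀ G₁ G₂ : IwasawaAlgebra 2, IsEvenBranchLiftAtTwo W₁ f₁ G₁ → IsEvenBranchLiftAtTwo W₂ f₂ G₂ →
      red (pfree G₁) = red (pfree G₂)

/-- GLUE (symbol form ⇒ `λ`-form at a fixed level): equal unit-normalised reductions have equal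
`λ`-invariants — `lam g` is by definition the `T`-order of `red (pfree g)`. [folklore] -/
theorem lam_eq_of_red_pfree_eq {G₁ G₂ : IwasawaAlgebra 2} (h : red (pfree G₁) = red (pfree G₂)) :
    lam G₁ = lam G₂ := by
  unfold lam; rw [h]

/-- Bookkeeping (proved): the symbol form yields the fixed-level `λ`-law of IMC-LINE with no `e`-terms — under the
hypotheses of `SymbolLineTransferAtTwo`, the even-branch lifts of an aligned same-level pair have equal `λ`-invariants. -/
theorem lam_eq_of_symbolLineTransferAtTwo (h : SymbolLineTransferAtTwo)
    (W₁ : WeierstrassCurve ℚ) [W₁.IsElliptic] [W₁.IsGloballyMinimal]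
    (W₂ : WeierstrassCurve ℚ) [W₂.IsElliptic] [W₂.IsGloballyMinimal]
    (h₁ : ∀ x : ℚ, ¬ HasRationalTwoTorsionX W₁ x) (h₂ : ∀ x : ℚ, ¬ HasRationalTwoTorsionX W₂ x)
    (F : Type) [Field F] [NumberField F] (hF : Module.finrank ℚ F = 3)
    (e₁ e₂ : F) (he₁ : aeval e₁ (twoDivisionUCubic W₁) = 0) (he₂ : aeval e₂ (twoDivisionUCubic W₂) = 0)
    (h2 : AlignedAtTwo F e₁ e₂)
    (hinf : AlignedAtInfinity F (twoDivisionUCubic W₁) (twoDivisionUCubic W₂) e₁ e₂)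
    {N : ℕ} [NeZero N] (f₁ f₂ : CuspForm (Gamma0 N) 2) (hf₁ : IsNewformOf W₁ f₁) (hf₂ : IsNewformOf W₂ f₂)
    (G₁ G₂ : IwasawaAlgebra 2) (hG₁ : IsEvenBranchLiftAtTwo W₁ f₁ G₁) (hG₂ : IsEvenBranchLiftAtTwo W₂ f₂ G₂) :
    lam G₁ = lam G₂ :=
  lam_eq_of_red_pfree_eq (h W₁ W₂ h₁ h₂ F hF e₁ e₂ he₁ he₂ h2 hinf f₁ f₂ hf₁ hf₂ G₁ G₂ hG₁ hG₂)

/-! ## Part C′ — the `S`-DEPLETED symbol identity ACROSS levels, `ι`-oriented (the EPW form at `p = 2`;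
MEMO-imc §10.21 (c′); REF1 §23 C′ SURVIVES)

Emerton–Pollack–Weston's mechanism (EPW06 Thm 1, §§3–5; Greenberg–Vatsal 2000 §§1–2 for the Euler-factor
elements `𝒫_ℓ(T) = P_ℓ(E, ℓ⁻¹γ_ℓ) ∈ Λ`, in the tree — TRANSPORTED TO THE TREE'S (MTT) VARIABLE, module note
«ORIENTATION of `T`» — as `GreenbergVatsal2000.eulerFactorElementInv` / `eulerFactorProductInv`) is an identity of
`Σ`-DEPLETED `p`-adic `L`-functions modulo `p`: for `Σ ⊇` the primes of `N₁N₂` other than `p`,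
`L_p^{Σ}(f₁) ≡ u · L_p^{Σ}(f₂)`, whence the `λ`-law with `e`-terms since `λ(𝒫̄_ℓ) = e_ℓ`. Its proof needs mod-`p`
multiplicity one at level `N₁N₂⋯`. CENSUS TEST at `p = 2` (`MEMO-imc-data/dimc8/scripts/xsym9b.py`, output
`dimc7/XSYM-census-m6.txt` 0490ec8dd7e96a54; resolution `m = 6`, the 32 odd cusps `a/64`; 2-STABILISED symbol
`ψ(a) = α^{-m}φ(a/2^m) − α^{-m-1}φ(a/2^{m-1})` for good ordinary reduction at `2` (`α` the unit root of `x² − a₂x + 2`),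
`ψ(a) = φ(a/2^m)` for multiplicative reduction; depletion by `Ē_ℓ(σ_ℓ⁻¹)` — on coefficient vectors
`(σ_ℓ⁻¹ψ)(a) = ψ(ℓ·a)`, script flag `eps = +1` — `Ē_ℓ = 1 + ā_ℓσ + σ²` (good) / `1 + σ` (multiplicative) / `1`
(additive), over the odd primes `ℓ ∣ N₁N₂`): ALIGNED at `2` and at `∞` ⇒ `Ē₁ψ̄₁ = Ē₂ψ̄₂` EXACTLY in 105/105 decisive
instances (70 off-stratum cross-level, 32 off-stratum same-level, 3 ON the Kilford stratum incl. the beyond-print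
cross-level pair `503c1 ~ 5030c1` on BOTH branches; 2 further instances deplete to zero at this resolution),
MISALIGNED ⇒ the depleted symbols differ in 36/37; D-imc-8 (`dimc8/j285501/XSYM-dimc8-m6.txt` 829cb3114e83e44d):
aligned ⇒ equal 2 180/2 180 decisive, misaligned ⇒ differ 341/345. Dropping the 2-stabilisation makes exactly the
good-versus-multiplicative-at-2 pairs fail (`53~106`, `61~122`, `503~5030`, `53~14734`) and nothing else: the data sees
the `p`-stabilisation term mod 2; the other orientation (`Ē_ℓ(σ_ℓ)`, GV's variable, script flag `eps = −1`) fails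
62:8 — it is off by the unit `(1+T)^κ` of the tree's orientation note (iv) (REF1 §23). So the statement below — EPW's
conclusion at `p = 2`, unit-normalised (so `u = 1`), with «multiplicity one» REPLACED by «aligned at `2` and at `∞`» —
is the cross-level MECHANISM statement; `AnalyticLineTransferAtTwo` follows from it via `λ(𝒫̄_ℓ(E)) = e_ℓ(E)`
(`= lambdaCorrectionAtTwo`, GV2000 Prop. 2.4 / EPW06 §5 read at `p = 2`; a support computation) and additivity of `lam`
over products with `μ = 0` factors; at a common level it gives back `SymbolLineTransferAtTwo` after cancelling the common
factor `red 𝒫̄` (same level ⇒ same reduction type at every bad prime ⇒ `𝒫̄_v(E₁) = 𝒫̄_v(E₂)` in `𝔽₂⟦T⟧`, an integral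
domain) — glue `red_pfree_eq_of_depleted_eq` below. -/

/-- **Candidate `SymbolLineTransferAtTwoSigmaR` (IMC-SYMB-Σ repaired = REF1 §23's C′; even branch, any two levels;
beyond print).** ORIENTATION (load-bearing): the depletion factor is the `ι`-ORIENTED
`GreenbergVatsal2000.eulerFactorProductInv W 2 S = ∏_{v∈S} P_v(E, ℓ⁻¹(1+T)^{−f_ℓ})` — GV's `𝒫_ℓ` written in
the tree's Mazur–Tate–Teitelbaum variable, in which the lifts `Gᵢ` (pinned by `IsEvenBranchLiftAtTwo`) live
(tree module note «ORIENTATION of `T`» (i), (iv) of `GreenbergVatsal2000/NonPrimitivePAdicLFunction.lean`). In the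
census script this is `eps = +1` (`(σ·ψ)(a) = ψ(ℓa)`, i.e. multiplication by `σ_ℓ⁻¹`): 105/105 + 2 180/2 180 (+ D-imc-9:
1 201/1 201 resolved, 0 fails). The GV-oriented variant with `eulerFactorProduct` (the v2.1–v2.3 text
`SymbolLineTransferAtTwoSigma`) is FALSE — REF1 §23, refuted-misstated (T15 ORIENTATION): mod 2,
`𝒫̄_ℓ = (1+T)^{f_ℓ k_ℓ} 𝒫̄_ℓ^ι` with `k_ℓ = deg P̄_ℓ`, so the hybrid pairing is off by the non-constant unit `(1+T)^κ`,
`κ = Σ f_ℓ (k_ℓ(E₁) − k_ℓ(E₂))`, non-zero exactly for cross-reduction-type pairs such as `503c1 ~ 5030c1` (census column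
`eps = −1`: fails). That name is retired.
Hypotheses of `SymbolLineTransferAtTwo` but with newforms `f₁ ∈ S₂(Γ₀(N₁))`, `f₂ ∈ S₂(Γ₀(N₂))`; for every
finite set `S` of finite places of `ℚ` avoiding `2` and containing every odd prime of `N₁N₂`, the
unit-normalised mod-2 reductions of the `S`-depleted lifts agree:
`red (pfree (G₁ · ∏_{v∈S} 𝒫_v^ι(E₁))) = red (pfree (G₂ · ∏_{v∈S} 𝒫_v^ι(E₂)))` in `𝔽₂⟦T⟧`. Why it might
fail: EPW's unit `u` could be a non-constant unit of `𝔽₂⟦T⟧` once multiplicity one fails (census: `u = 1`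
in 105/105), or a stable aligned pair could violate it outright (none found); extra good places `v ∈ S`
multiply both sides by `𝒫̄_v^ι(E₁) = 𝒫̄_v^ι(E₂)` (`a_v(E₁) ≡ a_v(E₂) mod 2` from `E₁[2] ≅ E₂[2]`) — harmless.
Sources: EPW06 Thm 1 (p odd, mult one); GV2000 §1 (8)–(10), Prop. 2.4; tree orientation note (i)/(iv); REF1 §23;
census above. REF2 v10/v11: Σ-form NOT IN PRINT at `2`; off-stratum odd levels in-print-assembly expected, on-stratum open.
[cite: EmertonPollackWeston2006, Thm. 1, §§3–5] [cite: GreenbergVatsal2000, §1 (8)–(10), Prop. 2.4] -/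
@[conjecture] def SymbolLineTransferAtTwoSigmaR : Prop :=
  ∀ (W₁ : WeierstrassCurve ℚ) [W₁.IsElliptic] [W₁.IsGloballyMinimal]
    (W₂ : WeierstrassCurve ℚ) [W₂.IsElliptic] [W₂.IsGloballyMinimal],
    (∀ x : ℚ, ¬ HasRationalTwoTorsionX W₁ x) → (∀ x : ℚ, ¬ HasRationalTwoTorsionX W₂ x) →
    ∀ (F : Type) [Field F] [NumberField F], Module.finrank ℚ F = 3 →
    ∀ e₁ e₂ : F, aeval e₁ (twoDivisionUCubic W₁) = 0 → aeval e₂ (twoDivisionUCubic W₂) = 0 →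
    AlignedAtTwo F e₁ e₂ →
    AlignedAtInfinity F (twoDivisionUCubic W₁) (twoDivisionUCubic W₂) e₁ e₂ →
    ∀ ⦃N₁ : ℕ⦄ [NeZero N₁] (f₁ : CuspForm (Gamma0 N₁) 2), IsNewformOf W₁ f₁ →
    ∀ ⦃N₂ : ℕ⦄ [NeZero N₂] (f₂ : CuspForm (Gamma0 N₂) 2), IsNewformOf W₂ f₂ →
    ∀ G₁ G₂ : IwasawaAlgebra 2, IsEvenBranchLiftAtTwo W₁ f₁ G₁ → IsEvenBranchLiftAtTwo W₂ f₂ G₂ →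
    ∀ S : Finset (HeightOneSpectrum (𝓞 ℚ)),
      (∀ v ∈ S, Rat.HeightOneSpectrum.natGenerator v ≠ 2) →
      (∀ ℓ ∈ (N₁ * N₂).primeFactors, ℓ ≠ 2 → ∃ v ∈ S, Rat.HeightOneSpectrum.natGenerator v = ℓ) →
      red (pfree (G₁ * GreenbergVatsal2000.eulerFactorProductInv W₁ 2 S)) =
        red (pfree (G₂ * GreenbergVatsal2000.eulerFactorProductInv W₂ 2 S))

/-- `pfree` commutes with multiplication by a factor of `μ = 0` (`red P ≠ 0`): for `G ≠ 0` this is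
`pfree_mul` + `F1Sign2.pfree_eq_self_of_red_ne_zero`; for `G = 0` both sides are the junk value `0`.
[folklore] -/
theorem pfree_mul_of_red_ne_zero (G P : IwasawaAlgebra 2) (hP : red P ≠ 0) :
    pfree (G * P) = pfree G * P := by
  have hP' : P ≠ 0 := by rintro rfl; exact hP (by simp [red])
  by_cases hG : G = 0
  · subst hG; simp [pfree]
  · rw [pfree_mul hG hP', pfree_eq_self_of_red_ne_zero hP]

/-- GLUE (Σ-form with equal depletion factors ⇒ undepleted symbol form), the shape used at a common
level: if the depleted unit-normalised reductions agree and the two depletion factors have the SAME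
non-zero reduction, then the undepleted unit-normalised reductions agree (`𝔽₂⟦T⟧` has no zero
divisors). Unconditional. [folklore] -/
theorem red_pfree_eq_of_depleted_eq {G₁ G₂ P₁ P₂ : IwasawaAlgebra 2}
    (hP : red P₁ = red P₂) (hP0 : red P₁ ≠ 0)
    (h : red (pfree (G₁ * P₁)) = red (pfree (G₂ * P₂))) :
    red (pfree G₁) = red (pfree G₂) := by
  have hP0' : red P₂ ≠ 0 := hP ▸ hP0
  have e : ∀ a b : IwasawaAlgebra 2, red (a * b) = red a * red b := fun a b =>
    map_mul (PowerSeries.map (IsLocalRing.residue ℤ_[2])) a b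
  rw [pfree_mul_of_red_ne_zero G₁ P₁ hP0, pfree_mul_of_red_ne_zero G₂ P₂ hP0', e, e, ← hP] at h
  exact mul_right_cancel₀ hP0 h

/-- Bookkeeping (proved): the Σ-form C′ gives back the fixed-level symbol form for any pair whose `ι`-oriented
depletion factors over a common admissible `S` have the same NON-ZERO mod-2 reduction (the same-level situation of
Part B: same conductor ⇒ same reduction type and `a_v(E₁) ≡ a_v(E₂)` at every `v ∈ S`, an input left explicit here). -/
theorem red_pfree_eq_of_symbolLineTransferAtTwoSigmaR (h : SymbolLineTransferAtTwoSigmaR)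
    (W₁ : WeierstrassCurve ℚ) [W₁.IsElliptic] [W₁.IsGloballyMinimal]
    (W₂ : WeierstrassCurve ℚ) [W₂.IsElliptic] [W₂.IsGloballyMinimal]
    (h₁ : ∀ x : ℚ, ¬ HasRationalTwoTorsionX W₁ x) (h₂ : ∀ x : ℚ, ¬ HasRationalTwoTorsionX W₂ x)
    (F : Type) [Field F] [NumberField F] (hF : Module.finrank ℚ F = 3)
    (e₁ e₂ : F) (he₁ : aeval e₁ (twoDivisionUCubic W₁) = 0) (he₂ : aeval e₂ (twoDivisionUCubic W₂) = 0)
    (h2 : AlignedAtTwo F e₁ e₂)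
    (hinf : AlignedAtInfinity F (twoDivisionUCubic W₁) (twoDivisionUCubic W₂) e₁ e₂)
    {N₁ : ℕ} [NeZero N₁] (f₁ : CuspForm (Gamma0 N₁) 2) (hf₁ : IsNewformOf W₁ f₁)
    {N₂ : ℕ} [NeZero N₂] (f₂ : CuspForm (Gamma0 N₂) 2) (hf₂ : IsNewformOf W₂ f₂)
    (G₁ G₂ : IwasawaAlgebra 2) (hG₁ : IsEvenBranchLiftAtTwo W₁ f₁ G₁) (hG₂ : IsEvenBranchLiftAtTwo W₂ f₂ G₂)
    (S : Finset (HeightOneSpectrum (𝓞 ℚ)))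
    (hS2 : ∀ v ∈ S, Rat.HeightOneSpectrum.natGenerator v ≠ 2)
    (hS : ∀ ℓ ∈ (N₁ * N₂).primeFactors, ℓ ≠ 2 → ∃ v ∈ S, Rat.HeightOneSpectrum.natGenerator v = ℓ)
    (hP : red (GreenbergVatsal2000.eulerFactorProductInv W₁ 2 S) =
      red (GreenbergVatsal2000.eulerFactorProductInv W₂ 2 S))
    (hP0 : red (GreenbergVatsal2000.eulerFactorProductInv W₁ 2 S) ≠ 0) :
    red (pfree G₁) = red (pfree G₂) :=
  red_pfree_eq_of_depleted_eq hP hP0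
    (h W₁ W₂ h₁ h₂ F hF e₁ e₂ he₁ he₂ h2 hinf f₁ hf₁ f₂ hf₂ G₁ G₂ hG₁ hG₂ S hS2 hS)

/-! ## Part D′ — the symbol form in CLASSICAL language: Vatsal's congruence at `p = 2`, SEMISTABLE at `2`
(MEMO-imc §10.21 (g′); sketch Part D repaired as REF1 §26.2 C′)

Vatsal 1999 §1 / Greenberg–Vatsal 2000 §3 (tree: `vatsal1999_plusSymbol_congruence`, stated for `p ≠ 2`)
prove: congruent eigenforms with `ρ̄_𝔪` irreducible AND multiplicity one (Condition 1,
`HasSimpleHeckeGenEigenspace`) have congruent, integral, residually non-zero canonically normalised plus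
modular symbols. The statement below is the same conclusion at `p = 2` for two rational newforms of one
level, with Condition 1 REPLACED by «aligned at `2` and at `∞`» — no Iwasawa algebra, no `L`-function: the
plus symbols `{∞, x}⁺`, suitably normalised, are `2`-integral for all `x ∈ ℚ`, congruent modulo the maximal
ideal of `ℤ̄₂` for all `x`, and a unit for some `x`. It implies `SymbolLineTransferAtTwo` (restrict to the
`2`-power cusps and pass to the Mazur–Tate/stabilised elements; the lift condition `IsEvenBranchLiftAtTwo`
fixes the normalisation up to `ℚˣ`, which `red ∘ pfree` ignores) and is STRONGER (all cusps, not only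
`a/2^m`). Heuristic (MEMO-imc §10.21 (g′)): by Weil-pairing adjunction the mod-2 plus symbol of `fᵢ` is
`c ↦ e_J(c, ιᵢ(Pᵢ⁻))` on `J₀(N)[2]_𝔪`, so the statement says the two curves share their archimedean
`2`-torsion point inside `J₀(N)` — verified in the form «same copy of `E[2]` in `J₀(N)[2]` ⟺ aligned at
`2`» on the census stratum levels 431, 503, 2089 (kit j287111). Sources: Vatsal 1999 (1.6), Thm (1.13); GV2000 §3
(18)–(19); census SYMTEST/XSYM; kit j287111.

REF1-AUDIT-v1 §26.2 (g4, ab5d8d85b9fc0770; evidence `HOME/REF1-data/b22/`, kit j288875 PSC2 phases A+B, j289153): the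
sketch's Part D `PlusSymbolCongruenceAtTwo` (no reduction clause at `2`) is KILLED AS TYPED — falsifier RUN (PARI 2.17.2
`msfromell`/`mseval`, exact): 16 620 pairs, 3 087 violations, ALL additive at `2` (minimal `348a1 ~ 348b1`: both alignment
predicates literally TRUE, content-free; plus symbols differ mod 2 on 336 of 720 Manin generators); C′ = the clause
«`W₁`, `W₂` semistable at `2`» (`REF1-data/b22/Cprime_PSC_semistable.lean` 3b468560784e84b3, rc 0): semistable at `2`,
typed-aligned ⇒ congruent 7 785/7 785 (mult 5 944, ord 441, ss 1 400; `N` up to 8 281), misaligned ⇒ 0/2 327; `C₃`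
semistable: 13 aligned (exactly one `G`-isomorphism each) all congruent, 35 unaligned none — two-sided on 10 112
semistable pairs. -imc g3 (planner of record) 2026-08-27T20:42:59Z: «re-type with the semistable-at-2 hypothesis per
REF1-data/b22/Cprime_PSC_semistable.lean». REF2 v10/v11: Part D «same words» as IMC-SYMB (OFF the Kilford stratum, `N`
odd: in-print-assembly; ON the stratum / even `N`: open beyond print). -/

/-- **Candidate `PlusSymbolCongruenceAtTwoSemistable` (IMC-SYMB′ = REF1 §26.2 C′ of the sketch's Part D: Vatsal's
plus-symbol congruence at `p = 2` with multiplicity one replaced by alignment, both curves SEMISTABLE at `2`; fixed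
level; beyond print on the Kilford stratum).** Body VERBATIM from `HOME/REF1-data/b22/Cprime_PSC_semistable.lean`
3b468560784e84b3 (= `SketchG2-Strata-v2.4.lean` fb67d6cce5549af6 Part D with the two semistability binders inserted).
Why it might fail: as IMC-SYMB, plus the integrality at NON-2-power cusps (cuspidal-subgroup 2-torsion; harmless after
`𝔪`-localisation since `ρ̄` is irreducible, but part of the claim here); WITHOUT the semistability clause it is FALSE
(additive at `2`: `348a1 ~ 348b1`). [cite: Vatsal1999, (1.6), Thm. 1.13] [cite: GreenbergVatsal2000, §3 (18)–(19)] -/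
@[conjecture] def PlusSymbolCongruenceAtTwoSemistable : Prop :=
  ∀ (W₁ : WeierstrassCurve ℚ) [W₁.IsElliptic] [W₁.IsGloballyMinimal]
    (W₂ : WeierstrassCurve ℚ) [W₂.IsElliptic] [W₂.IsGloballyMinimal],
    (∀ x : ℚ, ¬ HasRationalTwoTorsionX W₁ x) → (∀ x : ℚ, ¬ HasRationalTwoTorsionX W₂ x) →
    (W₁.HasGoodReductionAtPrime 2 ∨ W₁.HasMultiplicativeReductionAtPrime 2) →
    (W₂.HasGoodReductionAtPrime 2 ∨ W₂.HasMultiplicativeReductionAtPrime 2) →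
    ∀ (F : Type) [Field F] [NumberField F], Module.finrank ℚ F = 3 →
    ∀ e₁ e₂ : F, aeval e₁ (twoDivisionUCubic W₁) = 0 → aeval e₂ (twoDivisionUCubic W₂) = 0 →
    AlignedAtTwo F e₁ e₂ →
    AlignedAtInfinity F (twoDivisionUCubic W₁) (twoDivisionUCubic W₂) e₁ e₂ →
    ∀ ⦃N : ℕ⦄ [NeZero N] (f₁ f₂ : CuspForm (Gamma0 N) 2), IsNewformOf W₁ f₁ → IsNewformOf W₂ f₂ →
    ∀ ι : PadicAlgCl 2 ≃+* ℂ,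
    ∃ Ω₁ Ω₂ : ℂ, Ω₁ ≠ 0 ∧ Ω₂ ≠ 0 ∧
      (∀ x : ℚ, Valued.v (ι.symm (plusSymbol f₁ x / Ω₁)) ≤ 1) ∧
      (∀ x : ℚ, Valued.v (ι.symm (plusSymbol f₂ x / Ω₂)) ≤ 1) ∧
      (∃ x : ℚ, Valued.v (ι.symm (plusSymbol f₁ x / Ω₁)) = 1) ∧
      (∀ x : ℚ, Valued.v (ι.symm (plusSymbol f₁ x / Ω₁ - plusSymbol f₂ x / Ω₂)) < 1)

/-! ## Part E — the `S₃`-IMAGE form of Part B (REF1-AUDIT §46 (D6); planner-of-record ruling -imc g4 2026-08-28T00:10:06Z;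
appended by -ty g3)

REF1-AUDIT-v1 §46 (b43, 6e862c53309e0f1f, 2026-08-28T00:07:09Z; paper audit of REF2-PLACEMENT-v10 §1.2's fixed-level dictionary
«`φ̄₁ᵇ = φ̄₂ᵇ ⟺ same copy ∧ aligned`»), item (D6): for a `C₃`-image pair (`Δ ∈ ℚ^{×2}`, cyclic cubic 2-division field)
`Aut_G(ρ̄) = 𝔽₄^× ≅ C₃` gives THREE `G`-isomorphisms `E₁[2] → E₂[2]`; a pair `(e₁, e₂)` of roots in the common field `F` encodes ONE
of them, `AlignedAtInfinity` pins `e₂` given `e₁`, but the copy-induced `ψ_J` need not be that isomorphism, so the dictionary becomes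
«`φ̄₁ = φ̄₂ ⟺ same copy ∧ ψ_J-aligned`», which the typed predicates do not express (besides, `ρ̄` is then not absolutely
irreducible). Tree status per REF1: `CopyAlignmentAtTwo` (this folder, `CopyAlignmentAtTwo.lean`) CARRIES `¬ IsSquare W₁.Δ`;
`SymbolLineTransferAtTwo` (Part B above) does NOT — «recommend the same clause there (or a separate `C₃` sub-census before it is
read as covering square-discriminant pairs); one inserted hypothesis `¬ IsSquare W₁.Δ →` after the two no-2-torsion clauses; no
other row affected; not a kill — no `C₃` counterexample exhibited». RULING of the planner of record (-imc g4, HOME/INBOX.md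
2026-08-28T00:10:06Z): ACCEPT the hypothesis (every census instance of IMC-SYMB is `S₃`, so the BC5 table is unchanged) and, by
the tree rule «never change a landed statement's meaning in place — supersede», file a NEW `@[conjecture] def
SymbolLineTransferAtTwoS3` = the verbatim body of `SymbolLineTransferAtTwo` with the two binders `¬ IsSquare W₁.Δ → ¬ IsSquare W₂.Δ →`
inserted right after the two `HasRationalTwoTorsionX` binders, the proved weakening from the unrestricted form, and the
`λ`-corollary; CANDIDATES.md row IMC-SYMB re-signed to the `S₃` form. Typer's note on the second binder: under the remaining
hypotheses it is IMPLIED by the first (no rational 2-torsion ⇒ both `u`-cubics irreducible; a root of each lies in the common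
cubic field `F`, so `F = ℚ(e₁) = ℚ(e₂)` and both splitting fields are the Galois closure of `F` — of degree 6 iff `F` is not
cyclic — hence `IsSquare W₁.Δ ↔ IsSquare W₂.Δ`); it is kept because the planner's ruling spells the symmetric form (REF1's
one-clause form and this two-clause form are equivalent statements). `SymbolLineTransferAtTwoSigmaR` (Part C′) and
`PlusSymbolCongruenceAtTwoSemistable` (Part D′) carry the same root-pair encoding; REF1 §46: «no other row affected» — not
superseded here (the planner: «same treatment for `…SigmaR` if REF1 §46 applies to it»). -/

/-- **Candidate `SymbolLineTransferAtTwoS3` (IMC-SYMB on `S₃`-image pairs = Part B's `SymbolLineTransferAtTwo` with the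
`C₃` image excluded; REF1 §46 (D6) + planner ruling 2026-08-28T00:10:06Z).** REF1 §46: `C₃`-image pairs excluded; the
unrestricted Part B form `SymbolLineTransferAtTwo` is kept as the stronger, possibly-false-for-`C₃` statement (refutation
target), and implies this one (`symbolLineTransferAtTwoS3_of`). Body = the body of `SymbolLineTransferAtTwo` VERBATIM with the two
binders `¬ IsSquare W₁.Δ → ¬ IsSquare W₂.Δ →` inserted after the two no-rational-2-torsion clauses (with no rational 2-torsion,
`¬ IsSquare Δ` ⟺ the mod-2 image is all of `GL₂(𝔽₂) ≅ S₃` ⟺ `Aut_G(E[2]) = 1`, so the root pair `(e₁, e₂)` in the common cubic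
field pins THE identification `E₁[2] ≅ E₂[2]`). Census / BC5: unchanged — every census instance of IMC-SYMB is `S₃` (fixed level:
aligned ⇒ identical 33/33 and 483/483, `S₃`-misaligned ⇒ differ 29/29 and 2 113/2 113). Why it might fail: as Part B, minus the
`C₃` corner. [cite: BuzzardEtAl2001, Thm. 6.1] [cite: RibetStein2001, Rem. 3.6] [cite: Wiese2007Multiplicities, Cor. 4.4]
[cite: EmertonPollackWeston2006, Thm. 1] [cite: PollackWeston2011, §5] -/
@[conjecture] def SymbolLineTransferAtTwoS3 : Prop :=
  ∀ (W₁ : WeierstrassCurve ℚ) [W₁.IsElliptic] [W₁.IsGloballyMinimal]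
    (W₂ : WeierstrassCurve ℚ) [W₂.IsElliptic] [W₂.IsGloballyMinimal],
    (∀ x : ℚ, ¬ HasRationalTwoTorsionX W₁ x) → (∀ x : ℚ, ¬ HasRationalTwoTorsionX W₂ x) →
    ¬ IsSquare W₁.Δ → ¬ IsSquare W₂.Δ →
    ∀ (F : Type) [Field F] [NumberField F], Module.finrank ℚ F = 3 →
    ∀ e₁ e₂ : F, aeval e₁ (twoDivisionUCubic W₁) = 0 → aeval e₂ (twoDivisionUCubic W₂) = 0 →
    AlignedAtTwo F e₁ e₂ →
    AlignedAtInfinity F (twoDivisionUCubic W₁) (twoDivisionUCubic W₂) e₁ e₂ →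
    ∀ ⦃N : ℕ⦄ [NeZero N] (f₁ f₂ : CuspForm (Gamma0 N) 2), IsNewformOf W₁ f₁ → IsNewformOf W₂ f₂ →
    ∀ G₁ G₂ : IwasawaAlgebra 2, IsEvenBranchLiftAtTwo W₁ f₁ G₁ → IsEvenBranchLiftAtTwo W₂ f₂ G₂ →
      red (pfree G₁) = red (pfree G₂)

/-- PROVED weakening: the unrestricted Part B statement implies its `S₃`-image form (introduce the binders, discard the two
discriminant clauses, apply the hypothesis). -/
theorem symbolLineTransferAtTwoS3_of (h : SymbolLineTransferAtTwo) : SymbolLineTransferAtTwoS3 :=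
  fun W₁ _ _ W₂ _ _ h₁ h₂ _ _ F _ _ hF e₁ e₂ he₁ he₂ h2 hinf _ _ f₁ f₂ hf₁ hf₂ G₁ G₂ hG₁ hG₂ =>
    h W₁ W₂ h₁ h₂ F hF e₁ e₂ he₁ he₂ h2 hinf f₁ f₂ hf₁ hf₂ G₁ G₂ hG₁ hG₂

/-- Bookkeeping (proved): the `S₃` form yields the fixed-level `λ`-law of IMC-LINE with no `e`-terms on `S₃`-image pairs —
`lam_eq_of_symbolLineTransferAtTwo` restated from `SymbolLineTransferAtTwoS3`. -/
theorem lam_eq_of_symbolLineTransferAtTwoS3 (h : SymbolLineTransferAtTwoS3)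
    (W₁ : WeierstrassCurve ℚ) [W₁.IsElliptic] [W₁.IsGloballyMinimal]
    (W₂ : WeierstrassCurve ℚ) [W₂.IsElliptic] [W₂.IsGloballyMinimal]
    (h₁ : ∀ x : ℚ, ¬ HasRationalTwoTorsionX W₁ x) (h₂ : ∀ x : ℚ, ¬ HasRationalTwoTorsionX W₂ x)
    (hΔ₁ : ¬ IsSquare W₁.Δ) (hΔ₂ : ¬ IsSquare W₂.Δ)
    (F : Type) [Field F] [NumberField F] (hF : Module.finrank ℚ F = 3)
    (e₁ e₂ : F) (he₁ : aeval e₁ (twoDivisionUCubic W₁) = 0) (he₂ : aeval e₂ (twoDivisionUCubic W₂) = 0)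
    (h2 : AlignedAtTwo F e₁ e₂)
    (hinf : AlignedAtInfinity F (twoDivisionUCubic W₁) (twoDivisionUCubic W₂) e₁ e₂)
    {N : ℕ} [NeZero N] (f₁ f₂ : CuspForm (Gamma0 N) 2) (hf₁ : IsNewformOf W₁ f₁) (hf₂ : IsNewformOf W₂ f₂)
    (G₁ G₂ : IwasawaAlgebra 2) (hG₁ : IsEvenBranchLiftAtTwo W₁ f₁ G₁) (hG₂ : IsEvenBranchLiftAtTwo W₂ f₂ G₂) :
    lam G₁ = lam G₂ :=
  lam_eq_of_red_pfree_eq (h W₁ W₂ h₁ h₂ hΔ₁ hΔ₂ F hF e₁ e₂ he₁ he₂ h2 hinf f₁ f₂ hf₁ hf₂ G₁ G₂ hG₁ hG₂)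

end Summit.BirchSwinnertonDyer.Rank1Residual.F1Sign2

end
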